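import Literature.AlgebraicGeometry.ComplexMultiplication.CyclicTimesPrimeCMTypes
import HarnessLib

/-!
# Odd character sums over CM halves of `ℤ/2n × ℤ/2` (`n = 2^k`): a vanishing sum forces a translation symmetry

COR-CM (cell `pub-hodgecm2`), binder seat b04 (gen 20), count-neutral claim DICYCLIC-TWO-SHEET, part VIII — the
abelian input for the family `Q_{2^{k+2}} × C₂` (part IX, `CorCM/GaloisDicyclicTimesTwoNondegenerate`), companion of
gen 11's `CyclicTwoPower.sum_ne_zero_of_orderOf_eq_two_pow` (cyclic `ℤ/2^{k+1}`: no odd sum vanishes) and of part III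
(`ℤ/2^{k+1} q`: vanishing forces `q`-periodicity).  KERNEL ONLY: theorems; no definition, no named fact, no `sorry`.

SETTING.  `A = ℤ/2n × ℤ/2` written multiplicatively (`Multiplicative (ZMod (2n)) × Multiplicative (ZMod 2)`), `n = 2^k`,
involution `c = (n, 0)`, `T ⊆ A` a CM half (`u ∈ T ↔ c u ∉ T`), `χ` an ODD character (`χ(c) = -1`), so
`ω = χ(1,0)` satisfies `ω^n = -1` (minimal polynomial `X^n + 1`) and `ε = χ(0,1) = ±1`.  Then
`Σ_{u∈T} χ(u) = Σ_{r<n} (s_{r,0} + ε s_{r,1}) ω^r` with signs `s_{r,t} = ±1` (`+` iff `(r,t) ∈ T`), and the sum VANISHES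
iff `s_{r,0} = -ε s_{r,1}` for all `r`, i.e. iff `T` is stable under the translation `τ_ε = (n,1)` (`ε = 1`) resp.
`τ_ε = (0,1)` (`ε = -1`):

* `translate_mem_iff_of_sum_eq_zero` — `Σ_T χ = 0 ⟹ (ε = 1 → T·(n,1) = T) ∧ (ε = -1 → T·(0,1) = T)`, with
  `character_snd_eq_or` (`ε = ±1`).  The translation depends on `χ` only through `ε`: two CM halves killed by the
  SAME odd character share a non-trivial translation symmetry — the mechanism of part IX.

## References

* [Kubota1965] T. Kubota, Trans. AMS 118 (1965), §4 Lemma 2.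
* [Washington1997] L. C. Washington, *Introduction to Cyclotomic Fields*, §2 (the minimal polynomial `X^{2^k} + 1`).

Provenance: Literature home (namespace `Literature.AlgebraicGeometry.ComplexMultiplication.CyclicTwoPower`) of the Summits-side `CorCM/AbelianCyclicTimesTwoHalfSums` (cell `pub-hodgecm2`, COR-CM; all its imports are `Literature/`, Mathlib and the already re-homed `CyclicTimesPrimeCMTypes`), which `Literature/` may not import; theorems only, no named fact, no definition. Nothing here bears on `HC_CM`. Lane `lit-hodgefound` (Layer A3: CM types, their Kubota ranks and Galois combinatorics), seat p20.
-/

noncomputable section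

open Polynomial

namespace Literature.AlgebraicGeometry.ComplexMultiplication.CyclicTwoPower

open Literature.NumberTheory.NumberFields.RootOfUnityMonomials Literature.NumberTheory.ComplexMultiplication Literature.AlgebraicGeometry.HodgeTheory Literature.AlgebraicGeometry.Pohlmann1968

open Literature.NumberTheory.ComplexMultiplication

section Product

variable {n : ℕ} [NeZero n]

omit [NeZero n] in
/-- `ε = χ(0,1) = ±1`. [cite: Kubota1965, §4 Lemma 2] -/
theorem character_snd_eq_or (χ : AddChar (Additive (Multiplicative (ZMod (2 * n)) × Multiplicative (ZMod 2))) ℂ) :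
    χ (Additive.ofMul ((1, Multiplicative.ofAdd 1) : Multiplicative (ZMod (2 * n)) × Multiplicative (ZMod 2))) = 1 ∨
    χ (Additive.ofMul ((1, Multiplicative.ofAdd 1) : Multiplicative (ZMod (2 * n)) × Multiplicative (ZMod 2))) = -1 := by
  have h2 : ((1, Multiplicative.ofAdd 1) : Multiplicative (ZMod (2 * n)) × Multiplicative (ZMod 2)) *
      (1, Multiplicative.ofAdd 1) = 1 := by
    rw [Prod.mk_mul_mk, mul_one, ← ofAdd_add]
    rfl
  have h := congrArg (fun u => χ (Additive.ofMul u)) h2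
  simp only [ofMul_mul, AddChar.map_add_eq_mul, ofMul_one, AddChar.map_zero_eq_one] at h
  exact mul_self_eq_one_iff.1 h

/-- **A vanishing odd character sum over a CM half of `ℤ/2n × ℤ/2`, `n = 2^k`, forces a translation symmetry
determined by `ε = χ(0,1)`**: `T·(n,1) = T` if `ε = 1`, `T·(0,1) = T` if `ε = -1`. [cite: Kubota1965, §4 Lemma 2]
[cite: Washington1997, §2] -/
theorem translate_mem_iff_of_sum_eq_zero {k : ℕ} (hn : n = 2 ^ k)
    {T : Finset (Multiplicative (ZMod (2 * n)) × Multiplicative (ZMod 2))}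
    (hT : IsCMTypeWith ((Multiplicative.ofAdd (n : ZMod (2 * n)), 1) :
      Multiplicative (ZMod (2 * n)) × Multiplicative (ZMod 2)) (↑T : Set (Multiplicative (ZMod (2 * n)) × Multiplicative (ZMod 2))))
    (χ : AddChar (Additive (Multiplicative (ZMod (2 * n)) × Multiplicative (ZMod 2))) ℂ)
    (hχ : χ (Additive.ofMul ((Multiplicative.ofAdd (n : ZMod (2 * n)), 1) :
      Multiplicative (ZMod (2 * n)) × Multiplicative (ZMod 2))) = -1)
    (h0 : ∑ u ∈ T, χ (Additive.ofMul u) = 0) :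
    (χ (Additive.ofMul ((1, Multiplicative.ofAdd 1) : Multiplicative (ZMod (2 * n)) × Multiplicative (ZMod 2))) = 1 →
      ∀ u, u ∈ T ↔ u * (Multiplicative.ofAdd (n : ZMod (2 * n)), Multiplicative.ofAdd 1) ∈ T) ∧
    (χ (Additive.ofMul ((1, Multiplicative.ofAdd 1) : Multiplicative (ZMod (2 * n)) × Multiplicative (ZMod 2))) = -1 →
      ∀ u, u ∈ T ↔ u * (1, Multiplicative.ofAdd 1) ∈ T) := by
  classical
  have hnpos : 0 < n := NeZero.pos n
  let el : ℕ → ℕ → Multiplicative (ZMod (2 * n)) × Multiplicative (ZMod 2) :=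
    fun j t => (Multiplicative.ofAdd (j : ZMod (2 * n)), Multiplicative.ofAdd (t : ZMod 2))
  have hel : ∀ j t, el j t = (Multiplicative.ofAdd (1 : ZMod (2 * n)), (1 : Multiplicative (ZMod 2))) ^ j *
      ((1 : Multiplicative (ZMod (2 * n))), Multiplicative.ofAdd (1 : ZMod 2)) ^ t := fun j t => by
    simp only [el, Prod.pow_mk, one_pow, Prod.mk_mul_mk, one_mul, mul_one, ← ofAdd_nsmul, nsmul_eq_mul, mul_one]
  set ω : ℂ := χ (Additive.ofMul ((Multiplicative.ofAdd (1 : ZMod (2 * n)), 1) :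
    Multiplicative (ZMod (2 * n)) × Multiplicative (ZMod 2))) with hω
  set ε : ℂ := χ (Additive.ofMul ((1, Multiplicative.ofAdd (1 : ZMod 2)) :
    Multiplicative (ZMod (2 * n)) × Multiplicative (ZMod 2))) with hε
  have hχel : ∀ j t, χ (Additive.ofMul (el j t)) = ω ^ j * ε ^ t := fun j t => by
    rw [hel, ofMul_mul, AddChar.map_add_eq_mul, ofMul_pow, ofMul_pow, AddChar.map_nsmul_eq_pow,
      AddChar.map_nsmul_eq_pow]
  -- `ω^n = -1`, `ε² = 1`
  have hc_el : el n 0 = (Multiplicative.ofAdd (n : ZMod (2 * n)), 1) := by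
    simp only [el, Nat.cast_zero, ofAdd_zero]
  have hωn : ω ^ n = -1 := by
    have h := hχel n 0
    rw [hc_el, hχ, pow_zero, mul_one] at h
    exact h.symm
  have hε1 : ε = 1 ∨ ε = -1 := character_snd_eq_or χ
  have hεε : ε * ε = 1 := by rcases hε1 with h | h <;> rw [h] <;> norm_num
  -- the CM pairing: `(j + n, t) ∈ T ↔ (j, t) ∉ T`
  have hpair : ∀ j t : ℕ, el (j + n) t ∈ T ↔ el j t ∉ T := fun j t => by
    have h := hT.rho_smul_mem_iff (el j t)
    rw [Finset.mem_coe, Finset.mem_coe, smul_eq_mul] at h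
    have he : ((Multiplicative.ofAdd (n : ZMod (2 * n)), (1 : Multiplicative (ZMod 2))) :
        Multiplicative (ZMod (2 * n)) × Multiplicative (ZMod 2)) * el j t = el (j + n) t := by
      simp only [el, Prod.mk_mul_mk, one_mul, ← ofAdd_add, Nat.cast_add, add_comm]
    rwa [he] at h
  -- signs
  let s : ℕ → ℕ → ℚ := fun j t => if el j t ∈ T then 1 else -1
  -- reindexing `A` by `(Fin n × Fin 2) ⊕ (Fin n × Fin 2)`
  let e : (Fin n × Fin 2) ⊕ (Fin n × Fin 2) → Multiplicative (ZMod (2 * n)) × Multiplicative (ZMod 2) :=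
    Sum.elim (fun p => el p.1 p.2) (fun p => el (p.1 + n) p.2)
  have hcast : ∀ {m a b : ℕ}, a < m → b < m → (a : ZMod m) = (b : ZMod m) → a = b := by
    intro m a b ha hb h
    have := congrArg ZMod.val h
    rwa [ZMod.val_natCast, ZMod.val_natCast, Nat.mod_eq_of_lt ha, Nat.mod_eq_of_lt hb] at this
  have hel_inj : ∀ j j' t t' : ℕ, j < 2 * n → j' < 2 * n → t < 2 → t' < 2 → el j t = el j' t' →
      j = j' ∧ t = t' := by
    intro j j' t t' hj hj' ht ht' h
    simp only [el, Prod.mk.injEq, EmbeddingLike.apply_eq_iff_eq] at h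
    exact ⟨hcast hj hj' h.1, hcast ht ht' h.2⟩
  have hbij : Function.Bijective e := by
    rw [Fintype.bijective_iff_injective_and_card]
    refine ⟨?_, by simp [Fintype.card_sum, Fintype.card_prod, ZMod.card]; ring⟩
    rintro (rs | rs) (rs' | rs') h <;> dsimp only [e, Sum.elim_inl, Sum.elim_inr] at h
    · have hb := rs.1.2; have hb' := rs'.1.2
      obtain ⟨h1, h2⟩ := hel_inj _ _ _ _ (by omega) (by omega) rs.2.2 rs'.2.2 h
      exact congrArg Sum.inl (Prod.ext (Fin.ext h1) (Fin.ext h2))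
    · have hb := rs.1.2; have hb' := rs'.1.2
      obtain ⟨h1, -⟩ := hel_inj _ _ _ _ (by omega) (by omega) rs.2.2 rs'.2.2 h; omega
    · have hb := rs.1.2; have hb' := rs'.1.2
      obtain ⟨h1, -⟩ := hel_inj _ _ _ _ (by omega) (by omega) rs.2.2 rs'.2.2 h; omega
    · have hb := rs.1.2; have hb' := rs'.1.2
      obtain ⟨h1, h2⟩ := hel_inj _ _ _ _ (by omega) (by omega) rs.2.2 rs'.2.2 h
      exact congrArg Sum.inr (Prod.ext (Fin.ext (by omega)) (Fin.ext h2))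
  -- the sum as a polynomial expression in `ω`
  have hsum : ∑ u ∈ T, χ (Additive.ofMul u) =
      ∑ r ∈ Finset.range n, ((s r 0 + (if ε = 1 then 1 else -1) * s r 1 : ℚ) : ℂ) * ω ^ r := by
    have h1 : ∑ u ∈ T, χ (Additive.ofMul u) = ∑ u, if u ∈ T then χ (Additive.ofMul u) else 0 :=
      (Fintype.sum_ite_mem T _).symm
    rw [h1, ← Fintype.sum_bijective e hbij (fun p => if e p ∈ T then χ (Additive.ofMul (e p)) else 0) _
      (fun _ => rfl), Fintype.sum_sum_type, ← Finset.sum_add_distrib, Fintype.sum_prod_type, Finset.sum_range]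
    refine Finset.sum_congr rfl fun r _ => ?_
    rw [Fin.sum_univ_two]
    simp only [e, Sum.elim_inl, Sum.elim_inr, Fin.val_zero, Fin.val_one]
    have hεq : ((if ε = 1 then (1 : ℚ) else -1 : ℚ) : ℂ) = ε := by
      rcases hε1 with h | h
      · rw [if_pos h, h]; norm_num
      · rw [if_neg (by rw [h]; norm_num), h]; norm_num
    have key : ∀ t : ℕ, ((if el (r : ℕ) t ∈ T then χ (Additive.ofMul (el r t)) else 0) +
        if el ((r : ℕ) + n) t ∈ T then χ (Additive.ofMul (el (r + n) t)) else 0) = (s r t : ℂ) * (ω ^ (r : ℕ) * ε ^ t) := by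
      intro t
      rw [hχel, hχel, pow_add, hωn]
      by_cases hm : el r t ∈ T
      · have hm' : el (r + n) t ∉ T := fun h => (hpair r t).1 h hm
        simp only [hm, hm', if_true, if_false, s]; push_cast; ring
      · have hm' : el (r + n) t ∈ T := (hpair r t).2 hm
        simp only [hm, hm', if_true, if_false, s]; push_cast; ring
    rw [key 0, key 1, pow_zero, mul_one, pow_one]
    push_cast
    rw [hεq]
    ring
  -- hence every coefficient vanishes
  have hcoef : ∀ r < n, (s r 0 + (if ε = 1 then 1 else -1) * s r 1 : ℚ) = 0 := by
    by_contra hne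
    push Not at hne
    obtain ⟨r₀, hr₀, hne⟩ := hne
    let P : ℚ[X] := ∑ r ∈ Finset.range n, monomial r (s r 0 + (if ε = 1 then 1 else -1) * s r 1)
    have hP0 : P ≠ 0 := by
      intro h
      have : P.coeff r₀ = s r₀ 0 + (if ε = 1 then 1 else -1) * s r₀ 1 := by
        simp only [P, finsetSum_coeff, coeff_monomial]
        rw [Finset.sum_eq_single r₀ (fun i _ hi => if_neg hi) (fun h => absurd (Finset.mem_range.2 hr₀) h),
          if_pos rfl]
      rw [h, coeff_zero] at this
      exact hne this.symm
    have hPdeg : P.natDegree < n := by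
      have h1 : P.natDegree ≤ n - 1 :=
        natDegree_sum_le_of_forall_le _ _ fun i hi =>
          (natDegree_monomial_le _).trans (by have := Finset.mem_range.1 hi; omega)
      omega
    have hPeval : aeval ω P = ∑ r ∈ Finset.range n, ((s r 0 + (if ε = 1 then 1 else -1) * s r 1 : ℚ) : ℂ) * ω ^ r := by
      simp only [P, map_sum, aeval_monomial, eq_ratCast]
    exact aeval_ne_zero_of_pow_eq_neg_one hn hωn hP0 hPdeg (by rw [hPeval, ← hsum, h0])
  -- reading the coefficients
  have hs : ∀ j t, s j t = 1 ∨ s j t = -1 := fun j t => by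
    by_cases h : el j t ∈ T <;> norm_num [s, h]
  have hmem : ∀ j t, (el j t ∈ T ↔ s j t = 1) := fun j t => by
    by_cases h : el j t ∈ T <;> norm_num [s, h]
  -- every element of `A` is some `el j t` with `j < 2n`, `t < 2`
  have hcover : ∀ u : Multiplicative (ZMod (2 * n)) × Multiplicative (ZMod 2), ∃ j t : ℕ, j < 2 * n ∧ t < 2 ∧
      u = el j t := fun u => ⟨(Multiplicative.toAdd u.1).val, (Multiplicative.toAdd u.2).val, ZMod.val_lt _,
        ZMod.val_lt _, by simp only [el, ZMod.natCast_zmod_val, ofAdd_toAdd]⟩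
  -- translations
  have htr1 : ∀ j t, el j t * (Multiplicative.ofAdd (n : ZMod (2 * n)), Multiplicative.ofAdd 1) = el (j + n) (t + 1) :=
    fun j t => by simp only [el, Prod.mk_mul_mk, ← ofAdd_add, Nat.cast_add, Nat.cast_one]
  have htr2 : ∀ j t, el j t * ((1 : Multiplicative (ZMod (2 * n))), Multiplicative.ofAdd 1) = el j (t + 1) :=
    fun j t => by simp only [el, Prod.mk_mul_mk, mul_one, ← ofAdd_add, Nat.cast_add, Nat.cast_one]
  have hel2 : ∀ j t, el j (t + 2) = el j t := fun j t => by
    simp only [el, Nat.cast_add, Nat.cast_ofNat]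
    rw [show (2 : ZMod 2) = 0 from rfl, add_zero]
  have hel2n : ∀ j t, el (j + 2 * n) t = el j t := fun j t => by
    simp only [el, Nat.cast_add, ZMod.natCast_self, add_zero]
  have t_cases : ∀ t : ℕ, t < 2 → t = 0 ∨ t = 1 := fun t ht => by omega
  have j_cases : ∀ j : ℕ, j < 2 * n → j < n ∨ ∃ r, r < n ∧ j = r + n := fun j hj => by
    rcases Nat.lt_or_ge j n with h | h
    · exact Or.inl h
    · exact Or.inr ⟨j - n, by omega, by omega⟩
  constructor
  · -- `ε = 1`: `(r,0) ∈ T ↔ (r,1) ∉ T`, translation by `(n,1)`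
    intro hε_one u
    have hlow : ∀ r < n, (el r 0 ∈ T ↔ el r 1 ∉ T) := fun r hr => by
      have h := hcoef r hr
      rw [if_pos hε_one, one_mul] at h
      rw [hmem, hmem]
      rcases hs r 0 with h0 | h0 <;> rcases hs r 1 with h1 | h1 <;> rw [h0, h1] at h <;> norm_num at h <;>
        norm_num [h0, h1]
    obtain ⟨j, t, hj, ht, rfl⟩ := hcover u
    rw [htr1]
    rcases j_cases j hj with hjn | ⟨r, hr, rfl⟩ <;> rcases t_cases t ht with rfl | rfl
    · rw [hpair, hlow j hjn]
    · rw [show (1 : ℕ) + 1 = 0 + 2 from rfl, hel2, hpair, hlow j hjn, not_not]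
    · rw [hpair, show r + n + n = r + 2 * n by ring, hel2n, hlow r hr, not_not]
    · rw [hpair, show r + n + n = r + 2 * n by ring, hel2n, show (1 : ℕ) + 1 = 0 + 2 from rfl, hel2,
        hlow r hr]
  · -- `ε = -1`: `(r,0) ∈ T ↔ (r,1) ∈ T`, translation by `(0,1)`
    intro hε_neg u
    have hne : ε ≠ 1 := by rw [hε_neg]; norm_num
    have hlow : ∀ r < n, (el r 0 ∈ T ↔ el r 1 ∈ T) := fun r hr => by
      have h := hcoef r hr
      rw [if_neg hne] at h
      rw [hmem, hmem]
      rcases hs r 0 with h0 | h0 <;> rcases hs r 1 with h1 | h1 <;> rw [h0, h1] at h <;> norm_num at h <;>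
        norm_num [h0, h1]
    obtain ⟨j, t, hj, ht, rfl⟩ := hcover u
    rw [htr2]
    rcases j_cases j hj with hjn | ⟨r, hr, rfl⟩ <;> rcases t_cases t ht with rfl | rfl
    · exact hlow j hjn
    · rw [show (1 : ℕ) + 1 = 0 + 2 from rfl, hel2, hlow j hjn]
    · rw [hpair, hpair, hlow r hr]
    · rw [hpair, show (1 : ℕ) + 1 = 0 + 2 from rfl, hel2, hpair, hlow r hr]

end Product

end Literature.AlgebraicGeometry.ComplexMultiplication.CyclicTwoPower

end
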